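import Literature.NumberTheory.Transcendental.KZKernelConjectureForms
import Summits.KontsevichZagierPeriods.KontsevichZagierPeriods.Theorems.GrothendieckLemniscaticSectorGlue
import Summits.KontsevichZagierPeriods.KontsevichZagierPeriods.Theorems.GpcLegendreLemniscatic.Negative.Canonical
import Summits.KontsevichZagierPeriods.KontsevichZagierPeriods.Theorems.MultiplicationAccessible.Negative.Core
import Summits.KontsevichZagierPeriods.KontsevichZagierPeriods.Theorems.GrothendieckGpcZeta4Eq4zeta31
import Summits.KontsevichZagierPeriods.KontsevichZagierPeriods.Theorems.GrothendieckKEAlgIndependent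

/-!
# Strategist sketch — crux stmt-KontsevichZagierPeriods-11102 `Grothendieck.SectorComplement`

Typed, kernel-checked forms of the statements used in `STRATEGY-CENSUS.md`
(planner, crux-strategist mode, gen 1, 2026-08-16). Nothing here is a line or a stub: the file
records (§0) what the crux IS today, and (§1–§4) the best statement each lens produced, by NAME of the
existing route item where one exists, so the census can point at it.

* §0 `crux_iff_legendre_imp` : `SectorComplement ↔ (GpcLegendreLemniscatic → KontsevichZagierPeriods)`
  (H₂ = 0275 is a tree theorem; H₁ ↔ 0280 given the proved 8611), and
  `crux_iff_summit_iff_legendre` : `(SectorComplement ↔ KontsevichZagierPeriods) ↔ GpcLegendreLemniscatic`.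
* §2/§3 `summit_iff_integrality_and_algebraicKernel` : the tight two-piece split of the summit
  (Krull squeeze at `k = 1`): `KontsevichZagierPeriods ↔ IsDomain P ∧ (∀ c, evalP c = 0 → IsAlgebraic ℤ c)`,
  `P = KZ.FormalPeriodRing`.
* §4 `not_crux_iff_today` : `¬ SectorComplement ↔ GpcLegendreLemniscatic ∧ ¬ KontsevichZagierPeriods`.
-/

noncomputable section

set_option linter.dupNamespace false

namespace Summit.KontsevichZagierPeriods.KontsevichZagierPeriods.Cruxes.SectorComplement.Strategist

open Set MeasureTheory
open Literature.NumberTheory.Transcendental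
open Literature.NumberTheory.Transcendental.KZ
open Summit.KontsevichZagierPeriods.KontsevichZagierPeriods.Theses.Grothendieck
open Summit.KontsevichZagierPeriods.Grothendieck (gpcZeta4Eq4zeta31_proof keAlgIndependent_proof)
open Summit.KontsevichZagierPeriods.MultiplicationAccessible.Negative (mem_relations_of_nsmul_mem_relations)
open MvPolynomial (aeval X C)
open Summit.KontsevichZagierPeriods.Grothendieck.GpcLegendreLemniscaticNegative
  (kRep eRep gRep arctanRep legendreRep gpcLegendre_iff)
open Summit.KontsevichZagierPeriods.Grothendieck.LemniscaticSectorGlue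

/-! ## §0 Read-back: what the crux is today -/

/-- The summit IS the kernel form (tree theorem `kzKernelConjecture_iff_isRational`; restated here rather than
imported from the disprover's Cruxes module, whose farm snapshot is stale). [folklore] -/
theorem summit_iff_kernel : KontsevichZagierPeriods ↔ KZKernelConjecture :=
  kzKernelConjecture_iff_isRational.symm

/-- `H₂` (0275, `ζ(4) = 4ζ(3,1)` in the calculus) is a tree theorem. [folklore] -/
theorem h2_holds : GpcZeta4Eq4zeta31 := gpcZeta4Eq4zeta31_proof

/-- `ψ(L) = 4κε − 2κ² − ϖ = 0` in `P` from the sector kernel `H₁` at the single instance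
`4[m₁₁₀] − 2[m₂₀₀] − [m₀₀₁]` (ported verbatim from the disprover's Disproof.lean v2 §6b, whose farm
snapshot predates it; landed independently as `gpcLegendre_of_lsk` in p106420, pending). [folklore] -/
theorem aeval_formalPeriod_legendre_of_h1 (h1 : LemniscaticSectorKernel) (p : IntegralRep 1)
    (hpd : p.domain = univ) (hpi : p.integrand = fun x => 1 / (1 + x 0 ^ 2)) :
    aeval ![toFormalPeriod (of kRep), toFormalPeriod (of eRep), toFormalPeriod (of p)]
      (4 * X 0 * X 1 - 2 * X 0 ^ 2 - X 2 : MvPolynomial (Fin 3) ℤ) = 0 := by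
  let a : Fin 3 → ℕ := ![1, 2, 0]
  let b : Fin 3 → ℕ := ![1, 0, 0]
  let c : Fin 3 → ℕ := ![0, 0, 1]
  let z : Fin 3 → ℤ := ![4, -2, -1]
  choose m hmd hmi hmP using fun i => exists_monoRep p hpd hpi (a i) (b i) (c i)
  have hpoly : (∑ i, z i • (X 0 ^ a i * X 1 ^ b i * X 2 ^ c i : MvPolynomial (Fin 3) ℤ)) =
      4 * X 0 * X 1 - 2 * X 0 ^ 2 - X 2 := by
    simp only [Fin.sum_univ_three, a, b, c, z, Matrix.cons_val_zero, Matrix.cons_val_one,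
      Matrix.head_cons, Matrix.cons_val_two, Matrix.tail_cons]
    simp only [zsmul_eq_mul, Int.cast_ofNat, Int.cast_neg, Int.cast_one, pow_zero, pow_one, mul_one]
    ring
  have hS : toFormalPeriod (∑ i, z i • of (m i)) =
      aeval ![toFormalPeriod (of kRep), toFormalPeriod (of eRep), toFormalPeriod (of p)]
        (∑ i, z i • (X 0 ^ a i * X 1 ^ b i * X 2 ^ c i : MvPolynomial (Fin 3) ℤ)) := by
    rw [map_sum, map_sum]
    refine Finset.sum_congr rfl fun i _ => ?_
    rw [map_zsmul, map_zsmul, hmP]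
    simp only [map_mul, map_pow, MvPolynomial.aeval_X]
    rfl
  have heval : eval (∑ i, z i • of (m i)) = 0 := by
    rw [← evalP_toFormalPeriod, hS, evalP_aeval p (piRep_value p hpd hpi), hpoly]
    exact aeval_real_legendre
  have hmem : (∑ i, z i • of (m i)) ∈ relations :=
    h1 (Fin 3) z a b c m hmd (fun i x _ => by rw [hmi i]) heval
  rw [← hpoly, ← hS]
  exact toFormalPeriod_eq_zero_of_mem hmem

/-- `H₁ → 0280` (ported from Disproof.lean v2 §6b; torsion-freeness cancels the factor 2). [folklore] -/
theorem gpcLegendre_of_h1 (h1 : LemniscaticSectorKernel) : GpcLegendreLemniscatic := by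
  obtain ⟨p, hpd, hpi⟩ := exists_piRep
  have hL := aeval_formalPeriod_legendre_of_h1 h1 p hpd hpi
  have hg := toFormalPeriod_gRep
  have hp := toFormalPeriod_piRep p hpd hpi
  simp only [map_sub, map_mul, map_pow, MvPolynomial.aeval_X, map_ofNat] at hL
  simp only [Matrix.cons_val_zero, Matrix.cons_val_one, Matrix.head_cons, Matrix.cons_val_two,
    Matrix.tail_cons] at hL
  rw [gpcLegendre_iff]
  have h2 : (2 : ℕ) • (of legendreRep - of arctanRep) ∈ relations := by
    rw [← toFormalPeriod_eq_zero_iff, map_nsmul, map_sub]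
    have hprod : toFormalPeriod (of legendreRep) =
        toFormalPeriod (of gRep) * toFormalPeriod (of kRep) := by
      rw [toFormalPeriod_of_mul_of]; rfl
    rw [hprod]
    linear_combination hL + (2 * toFormalPeriod (of kRep)) * hg + hp
  exact mem_relations_of_nsmul_mem_relations two_ne_zero h2

/-- `H₁ ↔ 0280` unconditionally (8611 `keAlgIndependent_proof` is a tree theorem). [folklore] -/
theorem h1_iff_legendre : LemniscaticSectorKernel ↔ GpcLegendreLemniscatic :=
  ⟨gpcLegendre_of_h1, lemniscaticSectorGlue_proof keAlgIndependent_proof⟩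

/-- The summit implies 0280 (landed: `not_kontsevichZagierPeriods_of_not_gpcLegendre`). [folklore] -/
theorem legendre_of_summit (h : KontsevichZagierPeriods) : GpcLegendreLemniscatic := by
  by_contra hneg
  exact Summit.KontsevichZagierPeriods.Grothendieck.GpcLegendreLemniscaticNegative.not_kontsevichZagierPeriods_of_not_gpcLegendre
    hneg h

/-- **THE CRUX TODAY**: `SectorComplement ↔ (0280 → Statement)`. [folklore] -/
theorem crux_iff_legendre_imp :
    SectorComplement ↔ (GpcLegendreLemniscatic → KontsevichZagierPeriods) :=
  ⟨fun h h0280 => h (h1_iff_legendre.mpr h0280) h2_holds, fun h h1 _ => h (h1_iff_legendre.mp h1)⟩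

/-- **The crux is literally the summit iff Legendre's chain exists** (`H₁` idle ⟺ 0280). [folklore] -/
theorem crux_iff_summit_iff_legendre :
    (SectorComplement ↔ KontsevichZagierPeriods) ↔ GpcLegendreLemniscatic := by
  rw [crux_iff_legendre_imp]
  refine ⟨fun h => ?_, fun h0280 => ⟨fun h => h h0280, fun hs _ => hs⟩⟩
  by_contra h0280
  exact h0280 (legendre_of_summit (h.mp fun h' => absurd h' h0280))

/-! ## §1 Transfer — where each sibling's version of this step stops (typed pointers) -/

/-- T1 (mixed Tate / motivic MZVs). The first cross-root junction beyond the landed π-root ring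
(`piRootRing`, weights 2 and 4) is weight 3; its price is the ℚ-disjointness of `ζ(3)` from `ℚπ³`,
an OPEN irrationality statement (a VARIANT named for the census, not a cited fact). -/
def Zeta3OverPiCubedIrrational : Prop := Irrational ((riemannZeta 3).re / Real.pi ^ 3)

/-- T2 (1-motives, Huber–Wüstholz Thm 13.3). Its reach inside the calculus is exactly route
LowDimension's two cruxes; this is `Theses.LowDimension.LowdimBaker0DimLeOne` (10622) restated verbatim
(route files are not imported here: their farm snapshots churn). -/
def DimLeOneLayer : Prop :=
  ∀ ⦃n m : ℕ⦄, n ≤ 1 → m ≤ 1 → ∀ (r : IntegralRep n) (r' : IntegralRep m),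
    r.IsRational → r'.IsRational → r.value = r'.value → Equivalent r r'

/-- T2, second layer: planar areas = real 1-periods (`Theses.LowDimension.PlanarAreas`, 4990, XL, verbatim). -/
def PlanarAreasLayer : Prop :=
  ∀ (r r' : IntegralRep 2), (∀ p ∈ r.domain, r.integrand p = 1) → (∀ p ∈ r'.domain, r'.integrand p = 1) →
    r.value = r'.value → Equivalent r r'

/-- Both T2 layers are instances of the summit (so the transfer adds sectors, never touches the complement). [folklore] -/
theorem t2_layers_of_summit (h : KontsevichZagierPeriods) : DimLeOneLayer ∧ PlanarAreasLayer := by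
  rw [summit_iff_kernel, kzKernelConjecture_iff_kzPeriodConjecture'] at h
  exact ⟨fun n m _ _ r r' _ _ hv => h r r' hv, fun r r' _ _ hv => h r r' hv⟩

/-- T2: the first statement of the complement beyond `𝒫¹`-LINEAR relations is a QUADRATIC relation
among 1-periods — and the cheapest one is 0280 itself, the antecedent of this crux. [folklore] -/
theorem t2_first_quadratic_is_h1 : (GpcLegendreLemniscatic → KontsevichZagierPeriods) ↔ SectorComplement :=
  crux_iff_legendre_imp.symm

/-! T3 (function fields: Ayoub's relative theorem / ABP–Papanikolas). The non-transferring step is the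
numbers-to-functions lift, typed on other routes (not imported: route-file snapshots churn on the farm):
`Theses.LiftingCriteria.DilationLiftAtOne` (3571, rank 2), and in localised form
`Theses.AyoubSpecialisation.AyoubPiLocalKernel` (0541) with the transcendence-free seam
`Theses.AyoubSpecialisation.AyoubPiCancellation` (0540) — the `[π]`-instance of `Cancellation` below. -/

/-! ## §2 Strengthen — the rigid structural forms and what they are worth -/

/-- S4a INTEGRALITY of the formal period ring `P = FormalRep ⧸ relations` (a VARIANT of the summit
named for the census; its `[π]`-instance is AyoubSpecialisation 0540, its negation in witness form is
Neg 11011 `CancellationGap`). -/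
def Integrality : Prop := IsDomain FormalPeriodRing

/-- S4b REDUCEDNESS of `P` (VARIANT; weaker than integrality). -/
def Reducedness : Prop := IsReduced FormalPeriodRing

/-- S4c CANCELLATION: classes of non-zero value are non-zero-divisors (VARIANT; ring form of
`¬ CancellationGap`). -/
def Cancellation : Prop := ∀ u c : FormalPeriodRing, evalP u ≠ 0 → u * c = 0 → c = 0

/-- The transcendence half at `k = 1`: every value-zero formal period satisfies SOME non-zero integer
polynomial identity in `P` (polynomially AMPLIFIED Conjecture 1; VARIANT). -/
def AlgebraicKernel : Prop := ∀ c : FormalPeriodRing, evalP c = 0 → IsAlgebraic ℤ c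

/-! S1: the budgeted strengthening is route DimensionBudget's declared core
`Theses.DimensionBudget.OneExtraDimension` (3754; chains inside dimension ≤ max n m + 1) — ≥ summit by padding. -/

/-- The summit is injectivity of `evalP`. [folklore] -/
theorem summit_iff_evalP_injective : KontsevichZagierPeriods ↔ Function.Injective evalP := by
  rw [summit_iff_kernel, injective_iff_map_eq_zero]
  constructor
  · intro h x hx
    obtain ⟨c, rfl⟩ := toFormalPeriod_surjective x
    exact toFormalPeriod_eq_zero_of_mem (h c hx)
  · intro h c hc
    exact toFormalPeriod_eq_zero_iff.mp (h _ (by rwa [evalP_toFormalPeriod]))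

/-- Summit ⇒ `P` is a domain. [folklore] -/
theorem integrality_of_summit (h : KontsevichZagierPeriods) : Integrality :=
  Function.Injective.isDomain evalP (summit_iff_evalP_injective.mp h)

/-- Summit ⇒ `P` is reduced. [folklore] -/
theorem reducedness_of_summit (h : KontsevichZagierPeriods) : Reducedness :=
  isReduced_of_injective evalP (summit_iff_evalP_injective.mp h)

/-- Integrality ⇒ cancellation. [folklore] -/
theorem cancellation_of_integrality (h : Integrality) : Cancellation := by
  intro u c hu huc
  haveI : IsDomain FormalPeriodRing := h
  have hu0 : u ≠ 0 := fun h0 => hu (by rw [h0, map_zero])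
  exact (mul_eq_zero.mp huc).resolve_left hu0

/-- Summit ⇒ algebraic kernel (trivially: the kernel is `0`). [folklore] -/
theorem algebraicKernel_of_summit (h : KontsevichZagierPeriods) : AlgebraicKernel := by
  intro c hc
  have h0 : c = 0 := (injective_iff_map_eq_zero evalP).mp (summit_iff_evalP_injective.mp h) c hc
  subst h0
  exact isAlgebraic_zero

/-- `evalP` commutes with integer polynomial evaluation. [folklore] -/
theorem evalP_aeval_int (c : FormalPeriodRing) (p : Polynomial ℤ) :
    evalP (Polynomial.aeval c p) = Polynomial.aeval (evalP c) p := by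
  rw [Polynomial.aeval_def, Polynomial.aeval_def, Polynomial.hom_eval₂]
  congr 1
  ext n
  simp

/-- **KRULL SQUEEZE AT `k = 1` (tight split of the summit)**: Conjecture 1 for the calculus holds iff
`P` is a domain AND every value-zero class is algebraic over `ℤ` inside `P`. (⇐): `p(c) = 0`,
`p = X^k q`, `X ∤ q`; in a domain `c = 0` or `q(c) = 0`, and the latter evaluates to `q(0) = 0`. [folklore] -/
theorem summit_iff_integrality_and_algebraicKernel :
    KontsevichZagierPeriods ↔ (Integrality ∧ AlgebraicKernel) := by
  refine ⟨fun h => ⟨integrality_of_summit h, algebraicKernel_of_summit h⟩, fun ⟨hD, hA⟩ => ?_⟩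
  haveI : IsDomain FormalPeriodRing := hD
  rw [summit_iff_evalP_injective, injective_iff_map_eq_zero]
  intro c hc
  obtain ⟨p, hp, hpc⟩ := hA c hc
  obtain ⟨q, hq, hndvd⟩ := Polynomial.exists_eq_pow_rootMultiplicity_mul_and_not_dvd p hp 0
  rw [map_zero, sub_zero] at hq hndvd
  rw [hq, map_mul, map_pow, Polynomial.aeval_X] at hpc
  rcases mul_eq_zero.mp hpc with hck | hqc
  · exact pow_eq_zero_iff'.mp hck |>.1
  · exfalso
    apply hndvd
    rw [Polynomial.X_dvd_iff]
    have h1 : evalP (Polynomial.aeval c q) = 0 := by rw [hqc, map_zero]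
    rw [evalP_aeval_int, hc, Polynomial.aeval_def, Polynomial.eval₂_at_zero, eq_intCast, Int.cast_eq_zero] at h1
    exact h1

/-- Hence for THIS crux: modulo 0280 the two structural halves are exactly what is missing. [folklore] -/
theorem crux_iff_legendre_imp_split :
    SectorComplement ↔ (GpcLegendreLemniscatic → Integrality ∧ AlgebraicKernel) := by
  rw [crux_iff_legendre_imp, summit_iff_integrality_and_algebraicKernel]

/-! ## §3 Decomposition — the pieces of the best typed splits, by name -/

/-! D1 (Ayoub cube bridge, registered line ayoub-cube-bridge; typed in the tree file
Cruxes/SectorComplement/SketchIdeator1.lean and in route LiftingCriteria — not imported, see above):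
provable pieces `Theses.LiftingCriteria.CubeNashNormalForm` (3574, L), `SketchIdeator1.StokesSpanTransfer` (M/L),
`SketchIdeator1.DummyVariableMove` (S), cube calibration `intC = ∫` (M); the piece that remains the whole crux:
`SketchIdeator1.AyoubKernelConjecture` (≥ summit in print, Ayoub 2015 Fait 1.4).
D2 (π-localisation) = `Theses.AyoubSpecialisation.AyoubPiLocalKernel ∧ AyoubPiCancellation` (0541, 0540). -/

/-- D3 (Krull squeeze, tight): the two pieces of `summit_iff_integrality_and_algebraicKernel`. -/
abbrev D3Split : Prop := Integrality ∧ AlgebraicKernel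

/-- D3 is tight: it IS the summit. [folklore] -/
theorem d3_tight : D3Split ↔ KontsevichZagierPeriods := summit_iff_integrality_and_algebraicKernel.symm

/-! ## §4 Negation — anatomy of a refutation today, and the filed witnesses -/

/-- `¬ crux` today = Legendre's chain exists AND the summit fails. [folklore] -/
theorem not_crux_iff_today : ¬ SectorComplement ↔ (GpcLegendreLemniscatic ∧ ¬ KontsevichZagierPeriods) := by
  rw [crux_iff_legendre_imp, Classical.not_imp]

/-- N2a: the filed candidate counterexample pair, `Theses.Neg.NegTriplicationNotAccessible` (0311) restated
verbatim: Deligne's algebraic Γ-monomial `Γ̃(1,4,7,6)` on the degree-9 Fermat surface. -/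
def FiledWitnessGamma : Prop :=
  ¬ (∀ (r r' : IntegralRep 2), r.domain = {x | ∀ i, x i ∈ Set.Ioo (0:ℝ) 1} →
    Set.EqOn r.integrand (fun x => (x 0) ^ (-(8:ℝ)/9) * (1 - x 0) ^ (-(5:ℝ)/9) * (x 1) ^ (-(4:ℝ)/9) *
      (1 - x 1) ^ (-(2:ℝ)/9)) r.domain → r'.domain = {x | x 0 ^ 2 + x 1 ^ 2 < 4} →
    Set.EqOn r'.integrand (fun _ => (3:ℝ) ^ ((7:ℝ)/6) / 2) r'.domain → Equivalent r r')

/-! N2b: the filed structural counterexample shape is `Theses.Neg.CancellationGap` (11011; route Neg's deciding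
theorem `closes : CancellationGap → ¬ KontsevichZagierPeriods`); its ring form is `¬ Cancellation` above. -/

/-- A refutation of this crux through ANY refutation of the summit needs 0280 as well. [folklore] -/
theorem not_crux_of_not_summit (hneg : ¬ KontsevichZagierPeriods) (h0280 : GpcLegendreLemniscatic) :
    ¬ SectorComplement :=
  not_crux_iff_today.mpr ⟨h0280, hneg⟩

/-- … e.g. through a failure of cancellation in `P` (the ring shadow of Neg 11011). [folklore] -/
theorem not_crux_of_not_cancellation (hc : ¬ Cancellation) (h0280 : GpcLegendreLemniscatic) :
    ¬ SectorComplement :=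
  not_crux_of_not_summit (fun hs => hc (cancellation_of_integrality (integrality_of_summit hs))) h0280

/-- Conversely a refutation of the summit by ANY means refutes integrality-or-algebraic-kernel, and
the crux only together with 0280. [folklore] -/
theorem not_d3_of_not_summit (h : ¬ KontsevichZagierPeriods) : ¬ Integrality ∨ ¬ AlgebraicKernel := by
  rw [← not_and_or]
  exact fun hx => h (summit_iff_integrality_and_algebraicKernel.mpr hx)

end Summit.KontsevichZagierPeriods.KontsevichZagierPeriods.Cruxes.SectorComplement.Strategist
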